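import Summits.RiemannHypothesis.RiemannHypothesis.Theorems.UniversalFactorMediumUTables

/-!
# RiemannHypothesis / UniversalFactor — soundness of the certified `H_0` evaluator (soundness, III)

Route `RiemannHypothesis/UniversalFactor`, crux `MediumKernelNoGo` (stmt-RiemannHypothesis-2577), line
`one-sided-average-sign-test`.  The loop invariants of `osaNodeFactors` (`∋ e^{i x' ρ t_j}`), `osaCellZ`
(`∋ Σ_j ρW_jΦ_N(u_{cj}) e^{i x' ρ t_j}`) and `osaCellsLoop` (`∋ Σ_c GL_c`), and the main theorem
`mem_osaH0` (registered sub-goal `stub_memOsaH0`): for a valid context, `Re H_0(xn/xd) ∈ osaH0 C xn xd`.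
-/

set_option linter.dupNamespace false

noncomputable section

namespace Summit.RiemannHypothesis.RiemannHypothesis.Theorems

open MeasureTheory Set
open Literature.NumberTheory.LFunctions
open Literature.Analysis.ValidatedNumerics Literature.Analysis.ValidatedNumerics.NumericsMP

/-! ## The node factors, the cell sums and the outer loop -/

/-- The node factors enclose `e^{i x' ρ_u t_j}`. [folklore] -/
theorem UniversalFactor.osaNodeFactors_inv {C : UniversalFactor.OsaCtx} (hV : C.Valid) {xn xd : ℕ} (hxd : 0 < xd) :
    ∀ (n : ℕ) {NF : Array MC}, UniversalFactor.osaNodeFactors C xn xd n = some NF →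
      NF.size = n ∧ ∀ j < n, MC.mem C.S (Complex.exp ((((xn : ℝ) / xd * C.rho * UniversalFactor.osaNodeR j : ℝ) : ℂ) *
        Complex.I)) (NF.getD j (MC.ofInt C.S 0))
  | 0, NF, h => by
      simp only [UniversalFactor.osaNodeFactors, Option.some.injEq] at h
      subst h; simp
  | n + 1, NF, h => by
      simp only [UniversalFactor.osaNodeFactors] at h
      split at h
      · rename_i arr z harr hz
        simp only [Option.some.injEq] at h
        subst h
        have ih := UniversalFactor.osaNodeFactors_inv hV hxd n harr
        have hq : 0 < xd * C.rhoUd * UniversalFactor.osaGlS := by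
          have := hV.hrhod; unfold UniversalFactor.osaGlS; positivity
        have hmem : MI.mem C.S ((xn : ℝ) / xd * C.rho * UniversalFactor.osaNodeR n)
            (MI.ofFrac C.S ((xn : ℤ) * C.rhoUn * UniversalFactor.osaNodes.getD n 0) (xd * C.rhoUd * UniversalFactor.osaGlS)) := by
          have := MI.mem_ofFrac C.S ((xn : ℤ) * C.rhoUn * UniversalFactor.osaNodes.getD n 0) hq
          refine UniversalFactor.osa_mem_congr this ?_
          have h1 : (xd : ℝ) ≠ 0 := by exact_mod_cast hxd.ne'
          have h2 : (C.rhoUd : ℝ) ≠ 0 := by exact_mod_cast hV.hrhod.ne'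
          unfold UniversalFactor.OsaCtx.rho UniversalFactor.osaNodeR UniversalFactor.osaGlS
          push_cast
          field_simp
        have hzmem := MC.mem_expI hV.hS hV.hpi hz hmem
        refine ⟨by simp [ih.1], fun j hj => ?_⟩
        simp only [Array.getD_eq_getD_getElem?, Array.getElem?_push, ih.1]
        by_cases he : j = n
        · subst he
          simp only [if_true, Option.getD_some]
          exact hzmem
        · have hj' : j < n := by omega
          simp only [he, if_false]
          have := ih.2 j hj'
          simp only [Array.getD_eq_getD_getElem?] at this
          exact this
      · simp at h

/-- The weighted node sum of a cell encloses `z + Σ_{j<n} ρW_jΦ_N(u_{cj}) e^{i x' ρ t_j}`. [folklore] -/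
theorem UniversalFactor.osaCellZ_inv {C : UniversalFactor.OsaCtx} (hV : C.Valid) {x' : ℝ} {NF : Array MC}
    (hNF : ∀ j < 32, MC.mem C.S (Complex.exp (((x' * C.rho * UniversalFactor.osaNodeR j : ℝ) : ℂ) * Complex.I))
      (NF.getD j (MC.ofInt C.S 0)))
    {c : ℕ} (hc : c < C.Cu) :
    ∀ (n : ℕ), n ≤ 32 → ∀ {acc : MC} {z : ℂ}, MC.mem C.S z acc →
      MC.mem C.S (z + ∑ j ∈ Finset.range n,
        ((C.rho * UniversalFactor.osaWeightR j *
            UniversalFactor.osaPhiN C.Nth ((2 * c + 1) * C.rho + C.rho * UniversalFactor.osaNodeR j) : ℝ) : ℂ) *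
          Complex.exp (((x' * C.rho * UniversalFactor.osaNodeR j : ℝ) : ℂ) * Complex.I))
        (UniversalFactor.osaCellZ C NF c n acc)
  | 0, _, acc, z, hz => by simpa [UniversalFactor.osaCellZ] using hz
  | n + 1, hn, acc, z, hz => by
      simp only [UniversalFactor.osaCellZ]
      have ht := hV.htab c n hc (by omega)
      have hN := hNF n (by omega)
      set r : ℝ := C.rho * UniversalFactor.osaWeightR n *
        UniversalFactor.osaPhiN C.Nth ((2 * c + 1) * C.rho + C.rho * UniversalFactor.osaNodeR n) with hr
      set w : ℂ := Complex.exp (((x' * C.rho * UniversalFactor.osaNodeR n : ℝ) : ℂ) * Complex.I) with hw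
      have hacc' : MC.mem C.S (z + (r : ℂ) * w)
          ⟨acc.re.add (MI.mul C.S (C.phiTab.getD (c * 32 + n) (MI.ofInt C.S 0)) (NF.getD n (MC.ofInt C.S 0)).re),
           acc.im.add (MI.mul C.S (C.phiTab.getD (c * 32 + n) (MI.ofInt C.S 0)) (NF.getD n (MC.ofInt C.S 0)).im)⟩ := by
        constructor
        · have := MI.mem_add hz.1 (MI.mem_mul hV.hS ht hN.1)
          refine UniversalFactor.osa_mem_congr this ?_
          simp [Complex.add_re]
        · have := MI.mem_add hz.2 (MI.mem_mul hV.hS ht hN.2)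
          refine UniversalFactor.osa_mem_congr this ?_
          simp [Complex.add_im]
      have := UniversalFactor.osaCellZ_inv hV hNF hc n (by omega) hacc'
      rw [Finset.sum_range_succ]
      convert this using 1
      rw [hr, hw]
      push_cast
      ring

/-- `Re(e^{i x' u_c} · ρW_jΦ e^{i x' ρ t_j}) = ρ W_j Φ cos(x'(u_c + ρ t_j))`. [folklore] -/
theorem UniversalFactor.osa_re_rot (a b r : ℝ) :
    (Complex.exp (((a : ℝ) : ℂ) * Complex.I) * (((r : ℝ) : ℂ) * Complex.exp (((b : ℝ) : ℂ) * Complex.I))).re =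
      r * Real.cos (a + b) := by
  have : Complex.exp (((a : ℝ) : ℂ) * Complex.I) * (((r : ℝ) : ℂ) * Complex.exp (((b : ℝ) : ℂ) * Complex.I)) =
      ((r : ℝ) : ℂ) * Complex.exp (((a + b : ℝ) : ℂ) * Complex.I) := by
    rw [show (((a + b : ℝ) : ℂ) * Complex.I) = ((a : ℝ) : ℂ) * Complex.I + ((b : ℝ) : ℂ) * Complex.I by push_cast; ring,
      Complex.exp_add]
    ring
  rw [this, Complex.re_ofReal_mul, Complex.exp_ofReal_mul_I_re]

/-- The outer loop encloses `r + Σ_{Cu−fuel ≤ c < Cu} gls_c`. [folklore] -/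
theorem UniversalFactor.osaCellsLoop_inv {C : UniversalFactor.OsaCtx} (hV : C.Valid) {x' : ℝ} {NF : Array MC}
    (hNF : ∀ j < 32, MC.mem C.S (Complex.exp (((x' * C.rho * UniversalFactor.osaNodeR j : ℝ) : ℂ) * Complex.I))
      (NF.getD j (MC.ofInt C.S 0)))
    {B2 : MC} (hB2 : MC.mem C.S (Complex.exp (((2 * x' * C.rho : ℝ) : ℂ) * Complex.I)) B2) :
    ∀ (fuel : ℕ), fuel ≤ C.Cu → ∀ {P : MC} {acc : MI} {r : ℝ},
      MC.mem C.S (Complex.exp (((x' * ((2 * ((C.Cu - fuel : ℕ) : ℝ) + 1) * C.rho) : ℝ) : ℂ) * Complex.I)) P →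
      MI.mem C.S r acc →
      MI.mem C.S (r + ∑ c ∈ Finset.Ico (C.Cu - fuel) C.Cu, UniversalFactor.osaCellGL C.Nth C.rho x' c)
        (UniversalFactor.osaCellsLoop C NF B2 fuel P acc)
  | 0, _, P, acc, r, _, hr => by simpa [UniversalFactor.osaCellsLoop] using hr
  | fuel + 1, hfuel, P, acc, r, hP, hr => by
      simp only [UniversalFactor.osaCellsLoop]
      set c : ℕ := C.Cu - (fuel + 1) with hcdef
      have hc : c < C.Cu := by omega
      have hZ := UniversalFactor.osaCellZ_inv hV hNF hc 32 le_rfl (MC.mem_ofInt C.S 0)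
      simp only [Int.cast_zero, zero_add] at hZ
      set Zc : ℂ := ∑ j ∈ Finset.range 32, ((C.rho * UniversalFactor.osaWeightR j *
            UniversalFactor.osaPhiN C.Nth ((2 * c + 1) * C.rho + C.rho * UniversalFactor.osaNodeR j) : ℝ) : ℂ) *
          Complex.exp (((x' * C.rho * UniversalFactor.osaNodeR j : ℝ) : ℂ) * Complex.I) with hZc
      set p : ℂ := Complex.exp (((x' * ((2 * (c : ℝ) + 1) * C.rho)) : ℂ) * Complex.I) with hp
      have hP' : MC.mem C.S p P := by rw [hp]; exact_mod_cast hP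
      -- the real part of p * Zc is the gls sum of cell c
      have hre : MI.mem C.S (UniversalFactor.osaCellGL C.Nth C.rho x' c)
          ((MI.mul C.S P.re (UniversalFactor.osaCellZ C NF c 32 (MC.ofInt C.S 0)).re).sub
            (MI.mul C.S P.im (UniversalFactor.osaCellZ C NF c 32 (MC.ofInt C.S 0)).im)) := by
        have := MI.mem_sub (MI.mem_mul hV.hS hP'.1 hZ.1) (MI.mem_mul hV.hS hP'.2 hZ.2)
        refine UniversalFactor.osa_mem_congr this ?_
        rw [← Complex.mul_re, hZc, Finset.mul_sum, Complex.re_sum, UniversalFactor.osaCellGL]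
        refine Finset.sum_congr rfl fun j _ => ?_
        rw [hp, show ((x' * ((2 * (c : ℝ) + 1) * C.rho) : ℂ)) = (((x' * ((2 * (c : ℝ) + 1) * C.rho) : ℝ)) : ℂ) by push_cast; rfl,
          UniversalFactor.osa_re_rot]
        ring_nf
      -- next rotation factor
      have hPB : MC.mem C.S (Complex.exp (((x' * ((2 * ((C.Cu - fuel : ℕ) : ℝ) + 1) * C.rho) : ℝ) : ℂ) * Complex.I))
          (MC.mul C.S P B2) := by
        have := MC.mem_mul hV.hS hP' hB2
        convert this using 2
        rw [hp, ← Complex.exp_add]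
        congr 1
        have e : ((C.Cu - fuel : ℕ) : ℝ) = (c : ℝ) + 1 := by
          rw [show C.Cu - fuel = c + 1 by omega]; push_cast; rfl
        rw [e]; push_cast; ring
      have ih := UniversalFactor.osaCellsLoop_inv hV hNF hB2 fuel (by omega) hPB (MI.mem_add hr hre)
      rw [Finset.sum_eq_sum_Ico_succ_bot hc, show c + 1 = C.Cu - fuel by omega]
      convert ih using 1
      ring

/-! ## The u-side evaluator is sound -/

/-- **Soundness of the u-side evaluator**: `Re H_0(xn/xd) ∈ osaH0 C xn xd` for a valid context. [folklore] -/
theorem UniversalFactor.mem_osaH0 {C : UniversalFactor.OsaCtx} (hV : C.Valid) {xn xd : ℕ} (hxd : 0 < xd) {v : MI}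
    (h : UniversalFactor.osaH0 C xn xd = some v) :
    MI.mem C.S (deBruijnH 0 ((((xn : ℝ) / xd : ℝ)) : ℂ)).re v := by
  simp only [UniversalFactor.osaH0] at h
  split at h
  · rename_i B NF E hB hNF hE
    split_ifs at h with hEhi
    simp only [Option.some.injEq] at h
    subst h
    -- basic quantities
    set x' : ℝ := (xn : ℝ) / xd with hx'
    have hx0 : 0 ≤ x' := by positivity
    have hS := hV.hS
    have hSr : (0 : ℝ) < C.S := by exact_mod_cast hS
    have hρ0 : 0 < C.rho := by
      have := hV.hrho; have := hV.hrhod; unfold UniversalFactor.OsaCtx.rho; positivity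
    have hρR : C.rho < C.RU := by
      unfold UniversalFactor.OsaCtx.rho UniversalFactor.OsaCtx.RU
      rw [div_lt_div_iff₀ (by exact_mod_cast hV.hrhod) (by exact_mod_cast hV.hRd)]
      exact_mod_cast hV.hρR
    have hR4 : C.RU ≤ 1 / 4 := by
      unfold UniversalFactor.OsaCtx.RU
      rw [div_le_iff₀ (by exact_mod_cast hV.hRd)]
      have := hV.hR4
      have : (4 * C.RUn : ℝ) ≤ C.RUd := by exact_mod_cast this
      linarith
    -- enclosures of the rotation factors and of e^{x'R}
    have hxd' : (xd : ℝ) ≠ 0 := by exact_mod_cast hxd.ne'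
    have hrd' : (C.rhoUd : ℝ) ≠ 0 := by exact_mod_cast hV.hrhod.ne'
    have hRd' : (C.RUd : ℝ) ≠ 0 := by exact_mod_cast hV.hRd.ne'
    have hBmem : MC.mem C.S (Complex.exp (((x' * ((2 * ((C.Cu - C.Cu : ℕ) : ℝ) + 1) * C.rho) : ℝ) : ℂ) * Complex.I)) B := by
      have hm : MI.mem C.S (x' * C.rho) (MI.ofFrac C.S ((xn : ℤ) * C.rhoUn) (xd * C.rhoUd)) := by
        have := MI.mem_ofFrac C.S ((xn : ℤ) * C.rhoUn) (q := xd * C.rhoUd) (by have := hV.hrhod; positivity)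
        refine UniversalFactor.osa_mem_congr this ?_
        unfold UniversalFactor.OsaCtx.rho; rw [hx']; push_cast; field_simp
      have := MC.mem_expI hS hV.hpi hB hm
      convert this using 3
      simp
    have hB2 : MC.mem C.S (Complex.exp (((2 * x' * C.rho : ℝ) : ℂ) * Complex.I)) (MC.mul C.S B B) := by
      have hB1 : MC.mem C.S (Complex.exp (((x' * C.rho : ℝ) : ℂ) * Complex.I)) B := by
        convert hBmem using 3; simp
      have := MC.mem_mul hS hB1 hB1
      convert this using 2
      rw [← Complex.exp_add]; push_cast; ring_nf
    have hNF' := UniversalFactor.osaNodeFactors_inv hV hxd 32 hNF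
    have hEmem : MI.mem C.S (Real.exp (x' * C.RU)) E := by
      refine MI.mem_exp hS hE ?_
      have := MI.mem_ofFrac C.S ((xn : ℤ) * C.RUn) (q := xd * C.RUd) (by have := hV.hRd; positivity)
      refine UniversalFactor.osa_mem_congr this ?_
      unfold UniversalFactor.OsaCtx.RU; rw [hx']; push_cast; field_simp
    -- the gls sums
    have hs := UniversalFactor.osaCellsLoop_inv hV hNF'.2 hB2 C.Cu le_rfl hBmem (MI.mem_ofInt C.S 0)
    simp only [Nat.sub_self, Int.cast_zero, zero_add] at hs
    -- the analytic error
    set gls : ℝ := ∑ c ∈ Finset.Ico 0 C.Cu, UniversalFactor.osaCellGL C.Nth C.rho x' c with hgls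
    set h0 : ℝ := (deBruijnH 0 ((x' : ℝ) : ℂ)).re with hh0
    have hdec := UniversalFactor.osaH0_decomp x' hρ0.le C.Cu
    have hcells : ∀ c ∈ Finset.range C.Cu,
        |(∫ u in (2 * c * C.rho)..(2 * (c + 1) * C.rho), deBruijnPhi u * Real.cos (x' * u)) -
            UniversalFactor.osaCellGL C.Nth C.rho x' c| ≤
          UniversalFactor.osaPhiMajR C.Nth ((2 * c + 1) * C.rho) C.RU * Real.exp (x' * C.RU) *
              UniversalFactor.osaDefectR C.rho C.RU +
            2 * C.rho * UniversalFactor.osaThetaT C.Nth (2 * c * C.rho) :=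
      fun c _ => UniversalFactor.osaCell_error hV.hN hρ0.le hρR hR4 hx0 c
    have htail := UniversalFactor.osaUTail_error x' (U := 2 * C.Cu * C.rho) (by positivity)
    have herr : |h0 - gls| ≤ Real.exp (x' * C.RU) * (C.errA / C.S) + C.errB / C.S := by
      have e1 : h0 - gls = ∑ c ∈ Finset.range C.Cu,
          ((∫ u in (2 * c * C.rho)..(2 * (c + 1) * C.rho), deBruijnPhi u * Real.cos (x' * u)) -
            UniversalFactor.osaCellGL C.Nth C.rho x' c) +
          ∫ u in Ioi (2 * C.Cu * C.rho), deBruijnPhi u * Real.cos (x' * u) := by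
        rw [hh0, UniversalFactor.deBruijnH_zero_ofReal_re, hdec, hgls, Finset.range_eq_Ico, Finset.sum_sub_distrib]
        ring
      rw [e1]
      refine (abs_add_le _ _).trans ?_
      refine (add_le_add ((Finset.abs_sum_le_sum_abs _ _).trans (Finset.sum_le_sum hcells)) htail).trans ?_
      rw [Finset.sum_add_distrib, ← Finset.sum_mul, ← Finset.mul_sum, ← Finset.sum_mul, add_assoc]
      refine add_le_add ?_ hV.herrB
      have hA := hV.herrA
      have hE0 : 0 ≤ Real.exp (x' * C.RU) := (Real.exp_pos _).le
      calc (∑ i ∈ Finset.range C.Cu, UniversalFactor.osaPhiMajR C.Nth ((2 * i + 1) * C.rho) C.RU) *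
            Real.exp (x' * C.RU) * UniversalFactor.osaDefectR C.rho C.RU
          = Real.exp (x' * C.RU) * (UniversalFactor.osaDefectR C.rho C.RU *
              ∑ i ∈ Finset.range C.Cu, UniversalFactor.osaPhiMajR C.Nth ((2 * i + 1) * C.rho) C.RU) := by ring
        _ ≤ Real.exp (x' * C.RU) * (C.errA / C.S) := mul_le_mul_of_nonneg_left hA hE0
    -- in ulps
    have hulps : |h0 - gls| * C.S ≤ (Numerics.cdiv (E.hi * C.errA) C.S + C.errB : ℤ) := by
      have h1 : |h0 - gls| * C.S ≤ Real.exp (x' * C.RU) * C.errA + C.errB := by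
        have := mul_le_mul_of_nonneg_right herr hSr.le
        rw [add_mul, mul_assoc, div_mul_cancel₀ _ hSr.ne', div_mul_cancel₀ _ hSr.ne'] at this
        exact this
      have h2 : Real.exp (x' * C.RU) ≤ (E.hi : ℝ) / C.S := MI.le_hi_div hS hEmem
      have hA0 : (0 : ℝ) ≤ C.errA := by exact_mod_cast hV.herrA0
      have h3 : Real.exp (x' * C.RU) * C.errA ≤ (E.hi : ℝ) / C.S * C.errA := mul_le_mul_of_nonneg_right h2 hA0
      have h4 := Numerics.le_cdiv_mul_real (a := E.hi * C.errA) (b := C.S) (by exact_mod_cast hS)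
      have h5 : (E.hi : ℝ) / C.S * C.errA ≤ (Numerics.cdiv (E.hi * C.errA) C.S : ℝ) := by
        rw [div_mul_eq_mul_div, div_le_iff₀ hSr]; push_cast at h4 ⊢; exact h4
      push_cast
      linarith
    have := MI.mem_widen hs (x' := h0) (by rw [hh0] at hulps ⊢; exact hulps)
    rw [hh0, hx'] at this
    exact this
  · simp at h

/-- **Registered sub-goal `stub_memOsaH0`** (soundness of the u-side evaluator). [folklore] -/
theorem UniversalFactor.stub_memOsaH0 :
    ∀ (C : UniversalFactor.OsaCtx), C.Valid → ∀ (xn xd : ℕ), 0 < xd →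
      ∀ (v : Literature.Analysis.ValidatedNumerics.NumericsMP.MI), UniversalFactor.osaH0 C xn xd = some v →
        Literature.Analysis.ValidatedNumerics.NumericsMP.MI.mem C.S (deBruijnH 0 (((xn : ℝ) / xd : ℝ) : ℂ)).re v :=
  fun _ hV _ _ hxd _ h => UniversalFactor.mem_osaH0 hV hxd h

end Summit.RiemannHypothesis.RiemannHypothesis.Theorems
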